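import Summits.CriticalPhenomena.CardyFormulaZ2.Theses.CardySelfRefinement
import Literature.Probability.RandomPlanarGeometry.SLEUniquenessInLaw
import Summits.CriticalPhenomena.CardyFormulaZ2.Theorems.SubseqUpgrade.Negative.SubseqPrincipleNeedsUniqueness

/-!
# `SubseqUpgrade` (stmt-CriticalPhenomena-10279), negative side II: what the registered stubs
# must use, and the converse of the crux

Negative-side support for the crux `CardySelfRefinement.SubseqUpgrade` (cdisprove unit
refuter-cdisprove-stmt-CriticalPhenomena-10279-0, cycle 2; companion of
`SubseqPrincipleNeedsUniqueness.lean`; work file `Cruxes/SubseqUpgrade/Disproof.lean`). The crux is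
NOT refuted — it is a theorem; the registered skeleton `Lines/uniqueness-pin-subsequence.lean` cuts
it into the stubs `stub_lawCriterion` (subsequence principle for `TendstoLaw` on `𝓝[>] 0`) and
`stub_uniquenessPin` (uniqueness pin), both theorems. This file records, sorry-free and
definition-free:

* `not_lawCriterion_onMesh` — `stub_lawCriterion` becomes FALSE if its hypothesis is asked only
  of mesh sequences with values in the lattice mesh set `{1/(m+1)}`: EVERY positive null sequence
  is load-bearing (so a discharge of hypothesis (H2) of the crux along `δ = 1/n` only does not
  feed it);
* `tendstoLaw_of_pointwise_subseq` — conversely an `f`-DEPENDENT subsequence with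
  `Tendsto φ atTop atTop` suffices (a strengthening of `stub_lawCriterion` that holds), and
  `exists_subseq_tendsto_integral` — for probability laws such per-`f` convergent subsequences
  ALWAYS exist (Bolzano–Weierstrass): the content of (H2) is the identification of the limits as
  `∫ f dμ` for one chordal SLE₆ law `μ`, nothing else;
* `not_pin_without_identification` — `stub_uniquenessPin` with the identification "the
  subsequential limit law is a chordal SLE_κ law of `(D; a, b)`" deleted is FALSE (curve-valued
  oscillator between two constant curves under Dirac laws): the measure-level form of
  `not_subseq_principle_pair`;
* `subseqUpgrade_hyp_of_concl` — the CONVERSE of the crux: modulo an SLE₆ law in every Dobrushin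
  domain (`forall_exists_isSLELaw_six`, from the named fact `exists_isSLECurve`), the conclusion
  of `SubseqUpgrade` implies its hypothesis (H1) ∧ (H2) (identity subsequence): the crux is an
  equivalence and (H2) cannot be weakened in substance.
-/

noncomputable section

namespace Summit.CriticalPhenomena.CardyFormulaZ2.Theorems.SubseqUpgrade.Negative

open Filter MeasureTheory Topology
open scoped NNReal BoundedContinuousFunction
open Literature.Probability.RandomPlanarGeometry Literature.Probability.LatticeModels
  Literature.Probability.Percolation

/-! ## The law criterion (`stub_lawCriterion`): which mesh sequences, which subsequences -/

/-- The shifted sequence `1/(n+3/2)` tends to `0` within `(0, ∞)`. [folklore] -/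
theorem tendsto_offmesh_nhdsWithin_zero :
    Tendsto (fun n : ℕ => 1 / ((n : ℝ) + 3 / 2)) atTop (𝓝[>] (0 : ℝ)) := by
  refine tendsto_nhdsWithin_iff.2 ⟨?_, Eventually.of_forall fun n => Set.mem_Ioi.2 (by positivity)⟩
  exact tendsto_const_nhds.div_atTop
    (tendsto_atTop_add_const_right _ _ tendsto_natCast_atTop_atTop)

/-- **Lattice mesh sequences are not enough for `stub_lawCriterion`.** The subsequence principle
for `TendstoLaw` along `𝓝[>] 0` is FALSE when its hypothesis is asked only of mesh sequences with
values in the lattice mesh set `{1/(m+1) : m ∈ ℕ}` (hence of every subsequence of the harmonic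
mesh sequence, and of nothing else). Witness: trivial configuration spaces `Unit` with Dirac laws
and the deterministic real "interface" `indicator {1/(m+1)} 1` (value `1` on the mesh set, `0`
off it), limit `Z = 1`: along mesh-valued sequences the laws are constantly `δ_1`, along
`1/(n+3/2)` constantly `δ_0`. So every positive null sequence in hypothesis (H2) of
`SubseqUpgrade` is load-bearing. Billingsley (1999), Thm. 2.6 (the criterion needs all
subsequences of all sequences). [folklore] -/
theorem not_lawCriterion_onMesh :
    ¬ ∀ {Ωδ : ℝ → Type} [∀ δ, MeasurableSpace (Ωδ δ)] {Ω' : Type} [MeasurableSpace Ω']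
        {X : Type} [TopologicalSpace X]
        (Y : ∀ δ, Ωδ δ → X) (P : ∀ δ, Measure (Ωδ δ)) (Z : Ω' → X) (P' : Measure Ω'),
        (∀ s : ℕ → ℝ, (∀ n, s n ∈ Set.range fun m : ℕ => 1 / ((m : ℝ) + 1)) →
            (∀ n, 0 < s n) → Tendsto s atTop (𝓝 0) →
            ∃ φ : ℕ → ℕ, StrictMono φ ∧ ∀ f : X →ᵇ ℝ,
              Tendsto (fun n ↦ ∫ ω, f (Y (s (φ n)) ω) ∂P (s (φ n))) atTop
                (𝓝 (∫ ω, f (Z ω) ∂P'))) →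
          TendstoLaw Y P Z P' := by
  intro h
  -- a bounded continuous test function on `ℝ` with `g 0 = 0`, `g 1 = 1` (the clamp)
  obtain ⟨g, hg0, hg1⟩ : ∃ g : ℝ →ᵇ ℝ, g 0 = 0 ∧ g 1 = 1 :=
    ⟨BoundedContinuousFunction.ofNormedAddCommGroup (fun x : ℝ => max 0 (min 1 x))
      (continuous_const.max (continuous_const.min continuous_id)) 1 fun x => by
        rw [Real.norm_eq_abs, abs_le]
        exact ⟨by linarith [le_max_left (0 : ℝ) (min 1 x)], max_le zero_le_one (min_le_left _ _)⟩,
      by simp, by simp⟩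
  have key := @h (fun _ => Unit) (fun _ => inferInstance) Unit _ ℝ _
    (fun δ _ => Set.indicator (Set.range fun m : ℕ => 1 / ((m : ℝ) + 1)) (1 : ℝ → ℝ) δ)
    (fun _ => Measure.dirac ()) (fun _ => (1 : ℝ)) (Measure.dirac ()) ?_
  · have h0 : Tendsto (fun _ : ℕ => (0 : ℝ)) atTop (𝓝 (∫ _ω : Unit, g 1 ∂Measure.dirac ())) :=
      ((key g).comp tendsto_offmesh_nhdsWithin_zero).congr fun n => by
        show (∫ _ω : Unit, g (Set.indicator (Set.range fun m : ℕ => 1 / ((m : ℝ) + 1))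
          (1 : ℝ → ℝ) (1 / ((n : ℝ) + 3 / 2))) ∂Measure.dirac ()) = 0
        rw [indicator_offmesh n, integral_dirac, hg0]
    rw [integral_dirac, hg1] at h0
    exact one_ne_zero (tendsto_nhds_unique h0 tendsto_const_nhds)
  · intro s hs _ _
    refine ⟨id, strictMono_id, fun f => ?_⟩
    refine (tendsto_const_nhds (x := ∫ _ω : Unit, f 1 ∂Measure.dirac ())).congr fun n => ?_
    show _ = ∫ _ω : Unit, f (Set.indicator (Set.range fun m : ℕ => 1 / ((m : ℝ) + 1))
      (1 : ℝ → ℝ) (s n)) ∂Measure.dirac ()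
    obtain ⟨m, hm⟩ := hs n
    have hm' : s n = 1 / ((m : ℝ) + 1) := hm.symm
    rw [hm', indicator_mesh m]

/-- **`f`-dependent subsequences suffice** (a STRENGTHENING of `stub_lawCriterion` that holds;
`Tendsto φ atTop atTop` instead of `StrictMono φ`): `TendstoLaw` is tested one bounded continuous
function at a time, so the subsequence may depend on `f`. Billingsley (1999), Thm. 2.6; Mathlib
`Filter.tendsto_of_subseq_tendsto`. [folklore] -/
theorem tendstoLaw_of_pointwise_subseq {Ωδ : ℝ → Type*} [∀ δ, MeasurableSpace (Ωδ δ)]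
    {Ω' : Type*} [MeasurableSpace Ω'] {X : Type*} [TopologicalSpace X]
    (Y : ∀ δ, Ωδ δ → X) (P : ∀ δ, Measure (Ωδ δ)) (Z : Ω' → X) (P' : Measure Ω')
    (h : ∀ f : X →ᵇ ℝ, ∀ s : ℕ → ℝ, (∀ n, 0 < s n) → Tendsto s atTop (𝓝 0) →
        ∃ φ : ℕ → ℕ, Tendsto φ atTop atTop ∧
          Tendsto (fun n ↦ ∫ ω, f (Y (s (φ n)) ω) ∂P (s (φ n))) atTop (𝓝 (∫ ω, f (Z ω) ∂P'))) :
    TendstoLaw Y P Z P' := by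
  intro f
  refine tendsto_of_subseq_tendsto fun ns hns => ?_
  obtain ⟨δs, hδpos, hδlim, hδeq⟩ := exists_pos_seq_eventuallyEq hns
  obtain ⟨φ, hφ, hconv⟩ := h f δs hδpos hδlim
  exact ⟨φ, hconv.congr' ((hφ.eventually hδeq).mono fun n hn =>
    congrArg (fun δ => ∫ ω, f (Y δ ω) ∂P δ) hn)⟩

/-- **Per-`f` convergent subsequences always exist** (Bolzano–Weierstrass): for probability laws
the real sequence `∫ f (Y (s n) ·) dP (s n)` is bounded by `‖f‖`, so SOME subsequence converges to
SOME real number, with no hypothesis at all. What hypothesis (H2) of `SubseqUpgrade` adds is the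
identification of these limits as `∫ f dμ` for ONE chordal SLE₆ law `μ` (and one subsequence for
all `f`). [folklore] -/
theorem exists_subseq_tendsto_integral {Ωδ : ℝ → Type*} [∀ δ, MeasurableSpace (Ωδ δ)]
    {X : Type*} [TopologicalSpace X] (Y : ∀ δ, Ωδ δ → X) (P : ∀ δ, Measure (Ωδ δ))
    [∀ δ, IsProbabilityMeasure (P δ)] (f : X →ᵇ ℝ) (s : ℕ → ℝ) :
    ∃ L : ℝ, ∃ φ : ℕ → ℕ, StrictMono φ ∧
      Tendsto (fun n ↦ ∫ ω, f (Y (s (φ n)) ω) ∂P (s (φ n))) atTop (𝓝 L) := by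
  have hb : ∀ n, (∫ ω, f (Y (s n) ω) ∂P (s n)) ∈ Metric.closedBall (0 : ℝ) ‖f‖ := fun n => by
    rw [Metric.mem_closedBall, dist_zero_right]
    calc ‖∫ ω, f (Y (s n) ω) ∂P (s n)‖ ≤ ‖f‖ * ((P (s n)) Set.univ).toReal :=
          norm_integral_le_of_norm_le_const (Eventually.of_forall fun ω => f.norm_coe_le_norm _)
      _ = ‖f‖ := by simp
  obtain ⟨L, -, φ, hφ, hL⟩ := tendsto_subseq_of_bounded Metric.isBounded_closedBall hb
  exact ⟨L, φ, hφ, hL⟩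

/-! ## The pin (`stub_uniquenessPin`): identification of the limit law is load-bearing -/

/-- **`stub_uniquenessPin` without the identification of the limit laws is FALSE**: it is NOT
true that "every positive null sequence has a subsequence along which the laws converge to SOME
law" yields one random variable `Γ` on the pre-Wiener space whose law is every subsequential
limit. Witness: `Unit` configuration spaces with Dirac laws and a deterministic curve-valued
oscillator (one constant curve on the mesh set `{1/(m+1)}`, another off it): every sequence has a
subsequence with constant law, but the two Dirac laws differ on a bounded continuous test
function (truncated distance). Hence any proof of the pin must use that all subsequential limit
laws are THE chordal SLE_κ law of `(D; a, b)` (`IsSLELaw.unique'`). [folklore] -/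
theorem not_pin_without_identification :
    ¬ ∀ {Ωδ : ℝ → Type} [∀ δ, MeasurableSpace (Ωδ δ)]
        (Y : ∀ δ, Ωδ δ → CurveClass ℂ) (P : ∀ δ, Measure (Ωδ δ)),
        (∀ s : ℕ → ℝ, (∀ n, 0 < s n) → Tendsto s atTop (𝓝 0) →
            ∃ φ : ℕ → ℕ, StrictMono φ ∧ ∃ μ : Measure (CurveClass ℂ),
              ∀ f : CurveClass ℂ →ᵇ ℝ,
                Tendsto (fun n ↦ ∫ ω, f (Y (s (φ n)) ω) ∂P (s (φ n))) atTop
                  (𝓝 (∫ x, f x ∂μ))) →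
          ∃ Γ : (ℝ≥0 → ℝ) → CurveClass ℂ,
            ∀ s : ℕ → ℝ, (∀ n, 0 < s n) → Tendsto s atTop (𝓝 0) →
              ∃ φ : ℕ → ℕ, StrictMono φ ∧ ∀ f : CurveClass ℂ →ᵇ ℝ,
                Tendsto (fun n ↦ ∫ ω, f (Y (s (φ n)) ω) ∂P (s (φ n))) atTop
                  (𝓝 (∫ ω, f (Γ ω) ∂Literature.Probability.Process.preWienerMeasure)) := by
  intro h
  classical
  -- two distinct curve classes (constant curves at `0` and `1`) and a separating test function
  obtain ⟨c₀, c₁, hne⟩ : ∃ c₀ c₁ : CurveClass ℂ, c₀ ≠ c₁ :=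
    ⟨CurveClass.mk ⟨ContinuousMap.const unitInterval 0⟩,
      CurveClass.mk ⟨ContinuousMap.const unitInterval 1⟩,
      fun h => zero_ne_one (show (0 : ℂ) = 1 from congrArg CurveClass.source h)⟩
  obtain ⟨g, hg⟩ : ∃ g : CurveClass ℂ →ᵇ ℝ, g c₀ ≠ g c₁ := by
    refine ⟨BoundedContinuousFunction.ofNormedAddCommGroup (fun c => min 1 (dist c c₀))
      (continuous_const.min (continuous_id.dist continuous_const)) 1 fun c => ?_, ?_⟩
    · rw [Real.norm_eq_abs, abs_le]
      exact ⟨by linarith [le_min zero_le_one (dist_nonneg (x := c) (y := c₀))], min_le_left _ _⟩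
    · show min 1 (dist c₀ c₀) ≠ min 1 (dist c₁ c₀)
      rw [dist_self, min_eq_right (zero_le_one : (0 : ℝ) ≤ 1)]
      exact (lt_min one_pos (dist_pos.2 hne.symm)).ne
  -- the curve-valued oscillator
  set M : Set ℝ := Set.range fun m : ℕ => 1 / ((m : ℝ) + 1) with hM
  have hoffM : ∀ n : ℕ, 1 / ((n : ℝ) + 3 / 2) ∉ M := fun n hmem =>
    one_ne_zero ((Set.indicator_of_mem hmem (1 : ℝ → ℝ)).symm.trans (indicator_offmesh n))
  have key := @h (fun _ => Unit) (fun _ => inferInstance)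
    (fun δ _ => if δ ∈ M then c₁ else c₀) (fun _ => Measure.dirac ()) ?_
  · obtain ⟨Γ, hΓ⟩ := key
    obtain ⟨φ, -, h1⟩ := hΓ (fun n => 1 / ((n : ℝ) + 1)) (fun n => by positivity)
      tendsto_one_div_add_atTop_nhds_zero_nat
    obtain ⟨ψ, -, h0⟩ := hΓ (fun n => 1 / ((n : ℝ) + 3 / 2)) (fun n => by positivity)
      (tendsto_nhdsWithin_iff.1 tendsto_offmesh_nhdsWithin_zero).1
    have e1 : Tendsto (fun _ : ℕ => g c₁) atTop
        (𝓝 (∫ ω, g (Γ ω) ∂Literature.Probability.Process.preWienerMeasure)) :=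
      (h1 g).congr fun n => by
        show (∫ _ω : Unit, g (if 1 / (((φ n : ℕ) : ℝ) + 1) ∈ M then c₁ else c₀)
          ∂Measure.dirac ()) = _
        rw [if_pos (Set.mem_range_self (φ n)), integral_dirac]
    have e0 : Tendsto (fun _ : ℕ => g c₀) atTop
        (𝓝 (∫ ω, g (Γ ω) ∂Literature.Probability.Process.preWienerMeasure)) :=
      (h0 g).congr fun n => by
        show (∫ _ω : Unit, g (if 1 / (((ψ n : ℕ) : ℝ) + 3 / 2) ∈ M then c₁ else c₀)
          ∂Measure.dirac ()) = _
        rw [if_neg (hoffM (ψ n)), integral_dirac]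
    exact hg ((tendsto_nhds_unique e0 tendsto_const_nhds).symm.trans
      (tendsto_nhds_unique e1 tendsto_const_nhds))
  · intro s _ _
    by_cases hf : ∃ᶠ n in atTop, s n ∈ M
    · obtain ⟨φ, hφ, hφ'⟩ := extraction_of_frequently_atTop hf
      refine ⟨φ, hφ, Measure.dirac c₁, fun f => ?_⟩
      refine (tendsto_const_nhds (x := ∫ x, f x ∂Measure.dirac c₁)).congr fun n => ?_
      show _ = ∫ _ω : Unit, f (if s (φ n) ∈ M then c₁ else c₀) ∂Measure.dirac ()
      rw [if_pos (hφ' n), integral_dirac, integral_dirac]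
    · obtain ⟨φ, hφ, hφ'⟩ := extraction_of_eventually_atTop (not_frequently.1 hf)
      refine ⟨φ, hφ, Measure.dirac c₀, fun f => ?_⟩
      refine (tendsto_const_nhds (x := ∫ x, f x ∂Measure.dirac c₀)).congr fun n => ?_
      show _ = ∫ _ω : Unit, f (if s (φ n) ∈ M then c₁ else c₀) ∂Measure.dirac ()
      rw [if_neg (hφ' n), integral_dirac, integral_dirac]

/-! ## The converse of the crux (tightness) -/

/-- Chordal SLE₆ laws exist in every Dobrushin domain, from the named existence fact
`exists_isSLECurve` (Rohde–Schramm 2005, Thms 5.1 and 7.1; Lawler 2005, §6.3).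
[cite: RohdeSchramm2005] -/
theorem forall_exists_isSLELaw_six (hex : exists_isSLECurve) (D : DobrushinDomain) :
    ∃ μ : Measure (CurveClass ℂ), IsSLELaw 6 D μ := by
  obtain ⟨Γ, hΓ⟩ := hex (κ := 6) (by norm_num) D
  exact ⟨_, hΓ.isSLELaw_map⟩

/-- **Converse of `SubseqUpgrade`** (tightness of the crux): modulo a chordal SLE₆ law in every
Dobrushin domain (`forall_exists_isSLELaw_six`; needed only to define the chordal family at
domains the conclusion never visits), the CONCLUSION of the crux — convergence in law to chordal
SLE₆ for every Dobrushin domain and admissible discretisation family — implies its HYPOTHESIS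
(H1) ∧ (H2), with the identity subsequence and one chordal family for all mesh sequences
(uniqueness `IsSLELaw.eq_map_of_isSLECurve` matches it with the limit curve). So the crux is an
equivalence: (H2) cannot be weakened in substance, only repackaged. Billingsley (1999), Thm. 2.6;
Lawler (2005), §6.3. [folklore] -/
theorem subseqUpgrade_hyp_of_concl
    (hex : ∀ D : DobrushinDomain, ∃ μ : Measure (CurveClass ℂ), IsSLELaw 6 D μ)
    (hC : ∀ (D : DobrushinDomain) (E : ℝ → DiscreteDobrushin), ZdDiscretisationFamily D E →
      ConvergesInLawToSLE 6 D (Ωδ := fun _ => BondConfig (Site 2))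
        (fun δ => bondInterfaceIn D (E δ)) (fun _ => bondPercolation (zdGraph 2) half)) :
    (∀ (D : DobrushinDomain) (E : ℝ → DiscreteDobrushin), ZdDiscretisationFamily D E →
        ∀ᶠ δ in 𝓝[>] (0 : ℝ), AEMeasurable (bondInterfaceIn D (E δ))
          (bondPercolation (zdGraph 2) half)) ∧
      ∀ δs : ℕ → ℝ, (∀ n, 0 < δs n) → Tendsto δs atTop (𝓝 0) →
        ∃ φ : ℕ → ℕ, StrictMono φ ∧ ∃ P : ChordalFamily,
          (∀ D : DobrushinDomain, IsSLELaw 6 D (P D)) ∧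
            ∀ (D : DobrushinDomain) (E : ℝ → DiscreteDobrushin), ZdDiscretisationFamily D E →
              ∀ f : BoundedContinuousFunction (CurveClass ℂ) ℝ,
                Tendsto (fun n => ∫ ω, f (bondInterfaceIn D (E (δs (φ n))) ω)
                  ∂(bondPercolation (zdGraph 2) half)) atTop (𝓝 (∫ γ, f γ ∂(P D))) := by
  choose Pfam hPfam using hex
  refine ⟨fun D E hDE => ?_, fun δs hpos hlim => ⟨id, strictMono_id, Pfam, hPfam, ?_⟩⟩
  · obtain ⟨-, -, hmeas, -⟩ := hC D E hDE
    exact hmeas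
  · intro D E hDE f
    obtain ⟨Γ, hΓ, -, hT⟩ := hC D E hDE
    have hδ : Tendsto δs atTop (𝓝[>] (0 : ℝ)) :=
      tendsto_nhdsWithin_iff.2 ⟨hlim, Eventually.of_forall fun n => Set.mem_Ioi.2 (hpos n)⟩
    rw [(hPfam D).eq_map_of_isSLECurve hΓ,
      integral_map hΓ.aemeasurable f.continuous.aestronglyMeasurable]
    exact (hT f).comp hδ

end Summit.CriticalPhenomena.CardyFormulaZ2.Theorems.SubseqUpgrade.Negative
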